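import Summits.CriticalPhenomena.SAWScalingLimit.Theorems.SAWDefectDecoherenceMassRatioFlatRootRootSwapReduction

/-!
# Crux `SAWDefectDecoherence.MassRatio` (stmt-CriticalPhenomena-8550), line `flat-root-arc-swap` —
# every arc root carries positive mass from `b_δ`, and `RootSwapArc ⇒ WildRootRelease`

Companion of `…FlatRootRootSwapReduction.lean` (same namespace `…FlatRoot.RootSwapArc`): the lattice
geometry of the rows clause gives, eventually in the crux frame, `Z_{Λ_δ}(b_δ → a') > 0` for EVERY door
edge `a'` of the swap arc `S_δ` (`swapArcAllPositive`; the row-`m` run in either direction from the door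
of `b_δ`, cf. the landed `ArcSwap.stub_swapArcPositive` which gives one positive term), hence the
converse half of the wild/tame factorisation without a positivity hypothesis:
`wildRootRelease_of_rootSwapArc : RootSwapArc ε → ∀ datum, WildRootReleaseAt ε …` (pigeonhole over the
finite nonempty arc). Registered sub-goal proved here: `swapArcAllPositive_all`. Sources: line card
`Cruxes/MassRatio/Lines/flat-root-arc-swap.md`; Duminil-Copin–Smirnov 2012 §2 (mid-edge walks).
-/

noncomputable section

namespace Summit.CriticalPhenomena.SAWScalingLimit.Theorems.MassRatio.FlatRoot

open Literature.Probability.LatticeModels Literature.Probability.RandomPlanarGeometry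
open Literature.Probability.RandomPlanarGeometry.SAW
open Summit.CriticalPhenomena.SAWScalingLimit.Theorems.MassRatio.Negative
open Summit.CriticalPhenomena.SAWScalingLimit.Theorems.MassRatio.Renewal (Z)
open scoped Classical

namespace RootSwapArc

/-! ### Every arc root carries positive mass from `b_δ` (lattice geometry of the rows clause) -/

namespace AllPositive

/-- `|x - t| ≤ max |x₀ - t| |x₁ - t|` for `x` between `x₀` and `x₁`. [folklore] -/
theorem abs_sub_le_max {x x₀ x₁ t : ℝ} (h : x₀ ≤ x ∧ x ≤ x₁ ∨ x₁ ≤ x ∧ x ≤ x₀) :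
    |x - t| ≤ max |x₀ - t| |x₁ - t| := by
  have a0 := le_abs_self (x₀ - t)
  have b0 := neg_abs_le (x₀ - t)
  have a1 := le_abs_self (x₁ - t)
  have b1 := neg_abs_le (x₁ - t)
  have m0 := le_max_left |x₀ - t| |x₁ - t|
  have m1 := le_max_right |x₀ - t| |x₁ - t|
  rw [abs_le]
  rcases h with ⟨h0, h1⟩ | ⟨h1, h0⟩
  · constructor <;> linarith
  · constructor <;> linarith

/-- **Door structure of a boundary mid-edge inside the rows ball.** A boundary mid-edge of `Λ₀` whose
scaled midpoint satisfies `|δ·mid e − bpt| + δ/2 < ρ` is a vertical door edge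
`{bv (m₀-1) p, bv m₀ p}` of the flat piece, `p - m₀` even (cf. `ArcSwap.SwapArcPositive.door`, whose
nearness hypothesis `ρ/100` is relaxed here). [folklore] -/
theorem door' {bpt : ℂ} {ρ δ : ℝ} {Λ₀ : Finset HexVertex} {m₀ : ℤ} {e : Sym2 HexVertex}
    (hδ : 0 < δ) (hbd : e ∈ hexDomainBoundary Λ₀)
    (hnear : dist ((δ : ℂ) * hexMidpoint e) bpt + δ / 2 < ρ)
    (hrows : ∀ v : HexVertex, (δ : ℂ) * hexCenter v ∈ Metric.ball bpt ρ → (v ∈ Λ₀ ↔ m₀ ≤ v.1 1)) :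
    ∃ p : ℤ, (p - m₀) % 2 = 0 ∧ e = s(bv (m₀ - 1) p, bv m₀ p) := by
  obtain ⟨he, u, v, rfl, hv, hu⟩ := hbd
  have hadj : hexGraph.Adj u v := (SimpleGraph.mem_edgeSet _).1 he
  have h3 : (Real.sqrt 3)⁻¹ ≤ 1 := inv_le_one_of_one_le₀ (Real.one_le_sqrt.2 (by norm_num))
  have hcu : dist ((δ : ℂ) * hexCenter u) ((δ : ℂ) * hexMidpoint s(u, v)) ≤ δ / 2 := by
    rw [dist_eq_norm, hexMidpoint_mk]
    have e : (δ : ℂ) * hexCenter u - (δ : ℂ) * ((hexCenter u + hexCenter v) / 2) =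
        ((δ / 2 : ℝ) : ℂ) * (hexCenter u - hexCenter v) := by push_cast; ring
    rw [e, norm_mul, Complex.norm_real, Real.norm_of_nonneg (by positivity),
      norm_hexCenter_sub_of_adj hadj.symm]
    calc δ / 2 * (Real.sqrt 3)⁻¹ ≤ δ / 2 * 1 := by gcongr
      _ = δ / 2 := mul_one _
  have hcv : dist ((δ : ℂ) * hexCenter v) ((δ : ℂ) * hexMidpoint s(u, v)) ≤ δ / 2 := by
    rw [dist_eq_norm, hexMidpoint_mk]
    have e : (δ : ℂ) * hexCenter v - (δ : ℂ) * ((hexCenter u + hexCenter v) / 2) =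
        ((δ / 2 : ℝ) : ℂ) * (hexCenter v - hexCenter u) := by push_cast; ring
    rw [e, norm_mul, Complex.norm_real, Real.norm_of_nonneg (by positivity),
      norm_hexCenter_sub_of_adj hadj]
    calc δ / 2 * (Real.sqrt 3)⁻¹ ≤ δ / 2 * 1 := by gcongr
      _ = δ / 2 := mul_one _
  have hbu : (δ : ℂ) * hexCenter u ∈ Metric.ball bpt ρ := by
    rw [Metric.mem_ball]
    calc dist ((δ : ℂ) * hexCenter u) bpt
        ≤ dist ((δ : ℂ) * hexCenter u) ((δ : ℂ) * hexMidpoint s(u, v)) +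
          dist ((δ : ℂ) * hexMidpoint s(u, v)) bpt := dist_triangle _ _ _
      _ < ρ := by linarith
  have hbv : (δ : ℂ) * hexCenter v ∈ Metric.ball bpt ρ := by
    rw [Metric.mem_ball]
    calc dist ((δ : ℂ) * hexCenter v) bpt
        ≤ dist ((δ : ℂ) * hexCenter v) ((δ : ℂ) * hexMidpoint s(u, v)) +
          dist ((δ : ℂ) * hexMidpoint s(u, v)) bpt := dist_triangle _ _ _
      _ < ρ := by linarith
  have hru : row u < m₀ := by
    by_contra hc
    exact hu ((hrows u hbu).2 (not_lt.1 hc))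
  have hrv : m₀ ≤ row v := (hrows v hbv).1 hv
  rw [adj_iff] at hadj
  rcases hadj with ⟨h1, -⟩ | ⟨-, h2, -⟩ | ⟨h1, h2, h3⟩
  · exfalso; omega
  · exfalso; omega
  · have hru' : row u = m₀ - 1 := by omega
    have hrv' : row v = m₀ := by omega
    have eu : bv (m₀ - 1) (pos v) = u := by rw [← h1, ← hru']; exact bv_row_pos u
    have ev : bv m₀ (pos v) = v := by rw [← hrv']; exact bv_row_pos v
    exact ⟨pos v, by omega, by rw [eu, ev]⟩

/-- **Centres between two doors are in the rows ball.** If the door at `p₀` is `ρ/100`-close to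
`bpt` and the door at `p₁` is `ρ/2`-close, every brick vertex of rows `m₀, m₀ - 1` and position
between `p₀` and `p₁` has scaled centre in `B(bpt, ρ)` (`δ < ρ/100`). [folklore] -/
theorem center_mem_ball' {bpt : ℂ} {ρ δ : ℝ} {m₀ p₀ p₁ : ℤ} (hδ : 0 < δ) (hδρ : δ < ρ / 100)
    (hpar₀ : (p₀ - m₀) % 2 = 0) (hpar₁ : (p₁ - m₀) % 2 = 0)
    (hnear : dist ((δ : ℂ) * hexMidpoint s(bv (m₀ - 1) p₀, bv m₀ p₀)) bpt < ρ / 100)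
    (hfar : dist ((δ : ℂ) * hexMidpoint s(bv (m₀ - 1) p₁, bv m₀ p₁)) bpt ≤ ρ / 2)
    (r p : ℤ) (hr : r = m₀ ∨ r = m₀ - 1) (hp : p₀ ≤ p ∧ p ≤ p₁ ∨ p₁ ≤ p ∧ p ≤ p₀) :
    (δ : ℂ) * hexCenter (bv r p) ∈ Metric.ball bpt ρ := by
  rw [Metric.mem_ball, Complex.dist_eq]
  rw [ArcSwap.SwapArcPositive.scaled_door δ hpar₀, Complex.dist_eq] at hnear
  rw [ArcSwap.SwapArcPositive.scaled_door δ hpar₁, Complex.dist_eq] at hfar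
  have n_re := (Complex.abs_re_le_norm _).trans_lt hnear
  have n_im := (Complex.abs_im_le_norm _).trans_lt hnear
  have f_re := (Complex.abs_re_le_norm _).trans hfar
  simp only [Complex.sub_re, Complex.sub_im] at n_re n_im f_re
  have hre : ((δ : ℂ) * hexCenter (bv r p)).re = δ * ((p : ℝ) + 1) / 2 := by
    rw [re_scaled, pos_bv]
  have him1 := im_scaled_ge δ hδ.le (bv r p)
  have him2 := im_scaled_le δ hδ.le (bv r p)
  rw [row_bv] at him1 him2
  refine (Complex.norm_le_abs_re_add_abs_im _).trans_lt ?_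
  rw [Complex.sub_re, Complex.sub_im, hre]
  have hg := hgt_pos
  have hgl := hgt_lt
  have hδh : δ * hgt ≤ δ := by nlinarith
  have mono : ∀ {u w : ℤ}, u ≤ w → δ * ((u : ℝ) + 1) / 2 ≤ δ * ((w : ℝ) + 1) / 2 := by
    intro u w huw
    have huw' : (u : ℝ) ≤ w := by exact_mod_cast huw
    have := mul_le_mul_of_nonneg_left huw' hδ.le
    linarith
  have e1 : |δ * ((p : ℝ) + 1) / 2 - bpt.re| ≤ ρ / 2 := by
    have hb : δ * ((p₀ : ℝ) + 1) / 2 ≤ δ * ((p : ℝ) + 1) / 2 ∧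
        δ * ((p : ℝ) + 1) / 2 ≤ δ * ((p₁ : ℝ) + 1) / 2 ∨
        δ * ((p₁ : ℝ) + 1) / 2 ≤ δ * ((p : ℝ) + 1) / 2 ∧
        δ * ((p : ℝ) + 1) / 2 ≤ δ * ((p₀ : ℝ) + 1) / 2 := by
      rcases hp with ⟨h1, h2⟩ | ⟨h1, h2⟩
      · exact Or.inl ⟨mono h1, mono h2⟩
      · exact Or.inr ⟨mono h1, mono h2⟩
    refine (abs_sub_le_max hb).trans (max_le ?_ f_re)
    have hρ : 0 < ρ := by linarith
    exact le_of_lt (lt_of_lt_of_le n_re (by linarith))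
  have e2 : |((δ : ℂ) * hexCenter (bv r p)).im - bpt.im| ≤ δ + ρ / 100 := by
    rw [abs_lt] at n_im
    rw [abs_le]
    rcases hr with rfl | rfl
    · constructor <;> linarith
    · push_cast at him1 him2
      constructor <;> linarith
  linarith [e1, e2]

/-- **One fixed mesh: every arc door is reached from the marked door.** For `0 < δ < ρ/100`, a
boundary mid-edge `b₀` of `Λ₀` with `|δ·mid b₀ - bpt| < ρ/100`, the rows clause in `B(bpt, ρ)`, and a
boundary mid-edge `a'` with `|δ·mid a' - bpt| ∈ [ρ/4, ρ/2]`, the mass `Z_{Λ₀}(b₀ → a')` is positive: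
both are vertical doors of the flat piece (`door'`) and the run along row `m₀` between them stays in
`B(bpt, ρ) ∩ Λ₀` (`center_mem_ball'`, `ArcSwap.SwapArcPositive.walk`); a run to the LEFT is the reverse
of a run to the right (reciprocity `Z_symm`). [folklore] -/
theorem main' {bpt : ℂ} {ρ δ : ℝ} {Λ₀ : Finset HexVertex} {m₀ : ℤ} {b₀ a' : Sym2 HexVertex}
    (hδ : 0 < δ) (hδρ : δ < ρ / 100) (hbd : b₀ ∈ hexDomainBoundary Λ₀)
    (hnear : dist ((δ : ℂ) * hexMidpoint b₀) bpt < ρ / 100)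
    (hrows : ∀ v : HexVertex, (δ : ℂ) * hexCenter v ∈ Metric.ball bpt ρ → (v ∈ Λ₀ ↔ m₀ ≤ v.1 1))
    (ha'bd : a' ∈ hexDomainBoundary Λ₀)
    (ha'lo : ρ / 4 ≤ dist ((δ : ℂ) * hexMidpoint a') bpt)
    (ha'hi : dist ((δ : ℂ) * hexMidpoint a') bpt ≤ ρ / 2) :
    0 < Z Λ₀ b₀ a' := by
  have hρ : 0 < ρ := by linarith
  have hb₀M : b₀ ∈ hexDomainMidEdges Λ₀ := hexDomainBoundary_subset _ hbd
  have ha'M : a' ∈ hexDomainMidEdges Λ₀ := hexDomainBoundary_subset _ ha'bd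
  obtain ⟨p₀, hpar₀, rfl⟩ := ArcSwap.SwapArcPositive.door hδ hδρ hbd hnear hrows
  obtain ⟨p₁, hpar₁, rfl⟩ := door' hδ ha'bd (by linarith) hrows
  have hmem : ∀ r p : ℤ, (r = m₀ ∨ r = m₀ - 1) → (p₀ ≤ p ∧ p ≤ p₁ ∨ p₁ ≤ p ∧ p ≤ p₀) →
      (bv r p ∈ Λ₀ ↔ m₀ ≤ r) := by
    intro r p hr hp
    have h := hrows (bv r p) (center_mem_ball' hδ hδρ hpar₀ hpar₁ hnear ha'hi r p hr hp)
    rwa [show (bv r p).1 1 = r from row_bv r p] at h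
  rcases lt_trichotomy p₀ p₁ with hlt | heq | hgt
  · -- run to the right, from the marked door to the arc door
    obtain ⟨n, hn⟩ : ∃ n : ℕ, p₁ = p₀ + 2 * (n : ℤ) := ⟨((p₁ - p₀) / 2).toNat, by omega⟩
    have hn0 : 0 < n := by omega
    have hmem' : ∀ r p : ℤ, (r = m₀ ∨ r = m₀ - 1) → p₀ ≤ p → p ≤ p₀ + 2 * n →
        (bv r p ∈ Λ₀ ↔ m₀ ≤ r) := fun r p hr h1 h2 => hmem r p hr (Or.inl ⟨h1, by omega⟩)
    obtain ⟨hne, -⟩ := ArcSwap.SwapArcPositive.walk hn0 hpar₀ hmem'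
    rw [hn, Sym2.eq_swap (a := bv (m₀ - 1) (p₀ + 2 * (n : ℤ)))]
    exact Z_pos_of_nonempty hne
  · -- the two doors coincide: impossible by the distances
    subst heq
    exfalso
    linarith
  · -- run to the right from the arc door to the marked door, then reverse the walk
    obtain ⟨n, hn⟩ : ∃ n : ℕ, p₀ = p₁ + 2 * (n : ℤ) := ⟨((p₀ - p₁) / 2).toNat, by omega⟩
    have hn0 : 0 < n := by omega
    have hmem' : ∀ r p : ℤ, (r = m₀ ∨ r = m₀ - 1) → p₁ ≤ p → p ≤ p₁ + 2 * n →
        (bv r p ∈ Λ₀ ↔ m₀ ≤ r) := fun r p hr h1 h2 => hmem r p hr (Or.inr ⟨h1, by omega⟩)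
    obtain ⟨hne, -⟩ := ArcSwap.SwapArcPositive.walk hn0 hpar₁ hmem'
    rw [Z_symm hb₀M ha'M, hn, Sym2.eq_swap (a := bv (m₀ - 1) (p₁ + 2 * (n : ℤ)))]
    exact Z_pos_of_nonempty hne

end AllPositive

/-- **Every arc root carries positive mass from `b_δ`** (in the frame, eventually): uses `0 < ρ`,
the rows clause, `b_δ ∈ ∂Λ_δ` and `δ·mid b_δ → b` (as the landed `stub_swapArcPositive`, now for
EVERY `a' ∈ S_δ` instead of one). [folklore] -/
theorem swapArcAllPositive (D : DobrushinDomain) (ρ : ℝ) (Λ : ℝ → Finset HexVertex) (m : ℝ → ℤ)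
    (a b : ℝ → Sym2 HexVertex) : SwapArcAllPositive D ρ Λ m a b := by
  rintro ⟨hρ, -, hadm, -, -, hb⟩
  have h1 : ∀ᶠ δ : ℝ in nhdsWithin 0 (Set.Ioi 0),
      dist ((δ : ℂ) * hexMidpoint (b δ)) (D.pt 1) < ρ / 100 :=
    Metric.tendsto_nhds.1 hb (ρ / 100) (by positivity)
  have h2 : ∀ᶠ δ : ℝ in nhdsWithin 0 (Set.Ioi 0), 0 < δ ∧ δ < ρ / 100 := by
    filter_upwards [Ioo_mem_nhdsGT (show (0 : ℝ) < ρ / 100 by positivity)] with δ hδ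
    exact ⟨hδ.1, hδ.2⟩
  filter_upwards [hadm, h1, h2] with δ hA hB hC
  obtain ⟨-, -, hbd, -, -, -, hrows⟩ := hA
  rintro a' ⟨ha'bd, hlo, hhi⟩
  exact AllPositive.main' hC.1 hC.2 hbd hB hrows ha'bd hlo hhi

/-- **The stub already contains its wild core**: `RootSwapArc(ε) ⇒ W(ε)` for every datum,
unconditionally in the frame. [folklore] -/
theorem wildRootReleaseAt_of_rootSwapArcAt' {ε : ℝ} {D : DobrushinDomain} {ρ : ℝ}
    {Λ : ℝ → Finset HexVertex} {m : ℝ → ℤ} {a b : ℝ → Sym2 HexVertex}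
    (h : RootSwapArcAt ε D ρ Λ m a b) : WildRootReleaseAt ε D ρ Λ m a b :=
  wildRootReleaseAt_of_rootSwapArcAt h (swapArcAllPositive D ρ Λ m a b)

/-- Global corollary: the lead's `RootSwapArc ε` implies W for every datum. [folklore] -/
theorem wildRootRelease_of_rootSwapArc {ε : ℝ} (h : RootSwapArc ε) (D : DobrushinDomain) (ρ : ℝ)
    (Λ : ℝ → Finset HexVertex) (m : ℝ → ℤ) (a b : ℝ → Sym2 HexVertex) :
    WildRootReleaseAt ε D ρ Λ m a b :=
  wildRootReleaseAt_of_rootSwapArcAt' (h D ρ Λ m a b)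

/-- **Registered sub-goal (verbatim form): every arc root carries positive mass from `b_δ`,
eventually, at every datum of the crux frame.** -/
theorem swapArcAllPositive_all : ∀ (D : DobrushinDomain) (ρ : ℝ) (Λ : ℝ → Finset HexVertex) (m : ℝ → ℤ) (a b : ℝ → Sym2 HexVertex), SwapArcAllPositive D ρ Λ m a b :=
  fun D ρ Λ m a b => swapArcAllPositive D ρ Λ m a b

end RootSwapArc

end Summit.CriticalPhenomena.SAWScalingLimit.Theorems.MassRatio.FlatRoot
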